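import Summits.BirchSwinnertonDyer.Rank1Residual.Additive.RamifiedSevenGenusDepletedSeriesDirichlet
import Summits.BirchSwinnertonDyer.Rank1Residual.Additive.RamifiedSevenGenusMemberGrossencharacter
import Literature.NumberTheory.GaloisRepresentations.HeckeCharacterGrossencharakterOfInfinityType
import Literature.NumberTheory.GaloisRepresentations.HeckeCharacterFiniteIdeleValuesProofs
import Literature.NumberTheory.GaloisRepresentations.HeckeCharacterConductorExponent
import Literature.NumberTheory.GaloisRepresentations.ArtinReciprocityCharacterProofs
import HarnessLib

set_option autoImplicit false

/-!
# `𝒞₇` genus road (crux `EllipticUnitValueSevenOfGZK`, K7r), row K2C-5 block (λ2): the `ψ_conductor` BRIDGE —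
# `ψ((α)) = ι(α)` for `α ≡ 1 mod (7·d)` from a module of definition of `ψ` dividing `(7·d)` (honest partial, debt 0)

Cell `bsd-cm`, seat `bsd-cm-prr-ty1` g33 (literature-prover), SUMMON `wake/SUMMON-bsd-cm-prr-ty1-20260830T2227Z.md`
(3af2de90fa5f4927; planner D985), CHECK (CND) on the cell STATUS.  The field `ψ_conductor` of
`GenusSeven.PinnedKatoGenusFrame` (`RamifiedSevenGenusKatoPinnedFrame.lean` l.195–196) reads, for the frame's Grössencharacter
`ψ : HeckeCharacter Kcm` (type `(1,0)`) and complex embedding `ιC` of `K̄cm` (pinned to the infinite place):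
`∀ α : 𝓞 Kcm, α ≠ 0 → ((7 * F.d : ℕ) : 𝓞 Kcm) ∣ α - 1 → CM.heckeCharIdealValue ψ (Ideal.span {α}) = ιC (algebraMap Kcm K̄ α)`
— Kato's «`cond ψ ∣ (7·|D|)`» transcribed as in `CM.prop159_ellipticUnits_expStar_values` (de Shalit's `φ((α)) = α`,
II.1.4 (12)).  THIS FILE proves that letter from ONE typed hypothesis in the tree's idelic currency — a MODULE OF DEFINITION
`(T, f)` of `ψ` (`HeckeCharacter.IsModulus ψ T f`, Neukirch VII (6.11)) with `f_v ≥ 1` on `T` and `∏_{v ∈ T} 𝔭_v^{f_v} ∣ (m)`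
(here `m = 7·d`) — i.e. modulo exactly the sentence «the conductor of `ψ` divides `(7·d)`»; and it reduces that hypothesis
to LOCAL conductor exponents (`IsTrivialOnHigherUnitsAt`, Li–Xu §2.1.1), which is the form in which Gross (8.2.7) and the
tree's tame-conductor theorems deliver it for a `𝒞₇` member (CHECK (CND); the discharge modulo the named fact
`Gross_conductorExponent_baseChange_eq_two_mul` is a separate file).  No new definition, no named fact, no instance.

## Why a SHARP ray relation is needed (and proved here)

The tree's ideal-theoretic ray relations for an idelic Hecke character (`HasInfinityType.idealPow_span_eq`,
`IsModulus.coe_apply_infiniteIdeles_mul_idealPow_span_eq_one`, `HasInfinityType.idealPow_span_mul_embedding_eq`) are stated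
on the ray modulo `modulusIdeal T e = ∏_{v ∈ T} 𝔭_v^{e_v + 1}` — ONE exponent more than the module of definition `(T, e)`
kills (the `+1` makes the support of the modulus exactly `T` even where `e_v = 0`).  For the frame letter this slack is fatal:
at a split prime `𝔮 ∣ d` the Deuring character has conductor exponent `1` and `(7·d)` has `𝔮`-exponent `1`, so the relation
is needed on the ray modulo `∏_{v ∈ T} 𝔭_v^{e_v}` itself (all `e_v ≥ 1`).  §1 proves Neukirch's (6.13) in that sharp form,
by the tree's own decomposition of a principal idele (`HeckeCharacter.map_principalIdele_eq`): for `a ≡ 1 mod ∏ 𝔭_v^{e_v}`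
with all `e_v ≥ 1`, `a` is a unit at `T` and `⟨a⟩_v ∈ U_v^{(e_v)}` is killed by the module of definition, while off `T` the
local values are `χ(ϖ_v)^{ord_v a}` (`IsUnramifiedAt.coe_map_localUnits_eq_zpow`), whence `χ((a)_∞) · χ̃((a)) = 1`.

## Contents

* §1 (any number field) `coe_apply_infiniteIdeles_mul_idealPow_span_eq_one_of_sub_one_mem` — the SHARP Neukirch relation;
  `isModulus_of_isTrivialOnHigherUnitsAt` — local conductor exponents `f_v` on `T` + unramified off `T` ⇒ `IsModulus χ T f`
  (via the tree's `exists_isModulus`, `IsModulus.of_isUnramifiedAt`, `IsModulus.coe_apply_eq_prod_localUnits_of_fst_eq_one`).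
* §2 (imaginary quadratic `Kcm ∋ s`, `s² = −7`) ★ `heckeCharIdealValue_span_eq_of_isModulus` — for `ψ` of infinity type
  `(1,0)`, `ιC` pinned to the infinite place(s), a module of definition `(T, f)` with `f ≥ 1` on `T` and
  `∏_{v∈T} 𝔭_v^{f_v} ∣ (m)`: `∀ α ≠ 0, (m) ∣ α − 1 → CM.heckeCharIdealValue ψ (span{α}) = ιC(α)` — the `ψ_conductor` LETTER
  with `m := 7 * F.d`; ★★ `heckeCharIdealValue_span_eq_of_conductorExponents` — the same from local conductor exponents.

HONEST LABEL: a bridge modulo a typed hypothesis (the conductor bound), NOT an inhabitation of `ψ_conductor` for the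
Deuring character of a `𝒞₇` member (that needs `cond ψ ∣ 𝔭₇·(d)`: Gross (8.2.7), a named fact without `_holds`, plus
tameness at residue characteristic `≥ 5`); no `PinnedKatoGenusFrame` is constructed; no stub closes;
stmt-BirchSwinnertonDyer-19945 is OPEN; `X12.CMRamifiedSeven` is NOT proved; no summit statement is proved by this seat;
BSD is claimed for no curve.

References: [NeukirchANT1999] Ch. VII §6 Def. (6.11), Prop. (6.13), Cor. (6.14); [deShalit1987] II.1.1, II.1.4 (12) (p. 35);
[LiXu2026] §2.1.1 (conductor exponent); [Kato2004Asterisque] §15.7 (pp. 255–256), Prop. 15.9 (p. 258: `cond(ψ) ∣ (f)`);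
[Gross1980] §8.2 (8.2.7).
-/

noncomputable section

open scoped NumberField Classical ComplexConjugate
open NumberField NumberField.InfinitePlace IsDedekindDomain IsDedekindDomain.HeightOneSpectrum
open Literature.NumberTheory
open Literature.NumberTheory.GaloisRepresentations
open Literature.NumberTheory.GaloisRepresentations.HeckeCharacter
open Literature.NumberTheory.EllipticCurves.Kato2004

namespace Summit.BirchSwinnertonDyer.Rank1Residual.Additive.GenusSeven.ConductorBridge

/-! ## §1 Hecke-character algebra over any number field: the sharp ray relation; modules of definition from local exponents -/

section AnyField

variable {K : Type} [Field K] [NumberField K]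

/-- **Neukirch VII (6.13), SHARP form: `χ((a)_∞) · χ̃((a)) = 1` for `a ≡ 1 mod ∏_{v ∈ T} 𝔭_v^{e_v}`.**  Let `(T, e)` be a
module of definition of the Hecke character `χ` (`χ` kills the unit ideles `≡ 1 mod 𝔭_v^{e_v}` at `v ∈ T`) with `e_v ≥ 1`
on `T`, and `a ≠ 0` an integer with `a − 1 ∈ ∏_{v ∈ T} 𝔭_v^{e_v}`.  Then `χ((a)_∞) · ∏_𝔭 χ(ϖ_𝔭)^{ord_𝔭 a} = 1`
(`χ̃ = LFunctions.idealPow` of `v ↦ χ(ϖ_v)`).  Proof: Neukirch's decomposition of the principal idele `a`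
(`map_principalIdele_eq`) over `S = T ∪ {v : ord_v a ≠ 0}`; at `v ∈ T`, `a` is a unit congruent to `1 mod 𝔭_v^{e_v}`, so
`χ(⟨a⟩_v) = 1` (`map_prod_localUnits_eq_one_of_isModulus`); off `T`, `χ(⟨a⟩_v) = χ(ϖ_v)^{ord_v a}`
(`IsUnramifiedAt.coe_map_localUnits_eq_zpow`).  The tree's `IsModulus.coe_apply_infiniteIdeles_mul_idealPow_span_eq_one` is
the same on the smaller ray `a ≡ 1 mod ∏ 𝔭_v^{e_v+1}`. [cite: NeukirchANT1999, Ch. VII §6 Prop. (6.13) (proof) and Cor. (6.14)] -/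
theorem coe_apply_infiniteIdeles_mul_idealPow_span_eq_one_of_sub_one_mem {χ : HeckeCharacter K}
    {T : Finset (HeightOneSpectrum (𝓞 K))} {e : HeightOneSpectrum (𝓞 K) → ℕ} (hmod : IsModulus χ T e)
    (he : ∀ v ∈ T, 1 ≤ e v) {a : 𝓞 K} (ha : (a : K) ≠ 0) (ha1 : a - 1 ∈ ∏ v ∈ T, v.asIdeal ^ e v) :
    (χ (infiniteIdeles K (globalToInfiniteUnits K (Units.mk0 (a : K) ha))) : ℂ) *
        LFunctions.idealPow K (fun v => χ.valueAtUniformizer v) (Ideal.span {a}) = 1 := by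
  have ha0 : a ≠ 0 := fun h => ha (by rw [h]; rfl)
  set au : Kˣ := Units.mk0 (a : K) ha with hau
  -- `a - 1 ∈ 𝔭_v^{e_v}` and `a ∉ 𝔭_v` for `v ∈ T`
  have hmemv : ∀ v ∈ T, a - 1 ∈ v.asIdeal ^ e v := fun v hv =>
    Ideal.le_of_dvd (Finset.dvd_prod_of_mem (fun w => w.asIdeal ^ e w) hv) ha1
  have haT : ∀ v ∈ T, a ∉ v.asIdeal := by
    intro v hv haI
    have h1 : a - 1 ∈ v.asIdeal := Ideal.pow_le_self (by have := he v hv; omega) (hmemv v hv)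
    have : (1 : 𝓞 K) ∈ v.asIdeal := by
      have := v.asIdeal.sub_mem haI h1
      rwa [sub_sub_cancel] at this
    exact v.isPrime.ne_top ((Ideal.eq_top_iff_one _).mpr this)
  have hvala : ∀ v ∈ T, v.valuation K (a : K) = 1 := fun v hv =>
    (valuation_eq_one_iff_notMem (K := K) v).mpr (haT v hv)
  -- the finite set `S ⊇ T` outside which `a` is a unit
  set S : Finset (HeightOneSpectrum (𝓞 K)) :=
    T ∪ (finite_setOf_valuation_coe_ne_one (K := K) ha0).toFinset with hSdef
  have hTS : T ⊆ S := Finset.subset_union_left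
  have hSa : ∀ v ∉ S, v.valuation K (a : K) = 1 := fun v hv => by
    by_contra h
    exact hv (Finset.mem_union_right _ ((Set.Finite.mem_toFinset _).mpr h))
  -- Neukirch's decomposition of the principal idele `a`
  have hA := map_principalIdele_eq hmod au hTS hSa
  -- the part at `T` is killed by the module of definition (sharp: `a ≡ 1 mod 𝔭_v^{e_v}`)
  have hTpart : ∏ v ∈ T, χ (localUnits v (globalToLocalUnits v au)) = 1 := by
    rw [← map_prod]
    refine map_prod_localUnits_eq_one_of_isModulus hmod (fun v => globalToLocalUnits v au)
      (fun v hv => ?_) (fun v hv => ?_)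
    · rw [val_globalToLocalUnits, valued_algebraMap_adicCompletion, hau, Units.val_mk0, hvala v hv]
    · have hcast : (a : K) - 1 = algebraMap (𝓞 K) K (a - 1) := by rw [map_sub, map_one]
      rw [val_globalToLocalUnits, hau, Units.val_mk0, ← (algebraMap K (v.adicCompletion K)).map_one,
        ← map_sub, valued_algebraMap_adicCompletion, hcast, valuation_of_algebraMap]
      exact (intValuation_le_pow_iff_mem v (a - 1) (e v)).mpr (hmemv v hv)
  -- off `T` the local values are powers of `χ(ϖ_v)`
  have hval : ∀ v ∈ S \ T, (χ (localUnits v (globalToLocalUnits v au)) : ℂ) =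
      χ.valueAtUniformizer v ^ (Associates.mk v.asIdeal).count
        (Associates.mk (Ideal.span {a} : Ideal (𝓞 K))).factors := by
    intro v hv
    have hvT : v ∉ T := (Finset.mem_sdiff.mp hv).2
    rw [(isUnramifiedAt_of_isModulus' hmod hvT).coe_map_localUnits_eq_zpow (globalToLocalUnits v au)
      (m := ((Associates.mk v.asIdeal).count (Associates.mk (Ideal.span {a} : Ideal (𝓞 K))).factors : ℤ))
      (by rw [val_globalToLocalUnits, hau, Units.val_mk0]; exact valued_coe_ringOfIntegers v ha0), zpow_natCast]
  have hprod : LFunctions.idealPow K (fun v => χ.valueAtUniformizer v) (Ideal.span {a}) =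
      ((∏ v ∈ S \ T, χ (localUnits v (globalToLocalUnits v au)) : ℂˣ) : ℂ) := by
    rw [Units.coe_prod, LFunctions.idealPow, finprod_eq_prod_of_mulSupport_subset _ (s := S \ T) ?_]
    · exact Finset.prod_congr rfl fun v hv => (hval v hv).symm
    · intro v hv
      rw [Function.mem_mulSupport] at hv
      have hcnt : (Associates.mk v.asIdeal).count
          (Associates.mk (Ideal.span {a} : Ideal (𝓞 K))).factors ≠ 0 := fun h0 => hv (by rw [h0, pow_zero])
      have hdvd : v.asIdeal ∣ Ideal.span {a} :=
        (Associates.count_ne_zero_iff_dvd ((Submodule.ne_bot_iff _).mpr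
          ⟨a, Ideal.mem_span_singleton_self a, ha0⟩) v.irreducible).mp hcnt
      have hav : a ∈ v.asIdeal := Ideal.dvd_span_singleton.mp hdvd
      rw [Finset.coe_sdiff, Set.mem_sdiff, Finset.mem_coe, Finset.mem_coe]
      refine ⟨?_, fun hvT => haT v hvT hav⟩
      by_contra hvS
      have := hSa v hvS
      rw [valuation_eq_one_iff_notMem (K := K) v] at this
      exact this hav
  -- assemble
  rw [← Finset.prod_sdiff hTS, hTpart, mul_one] at hA
  have h1 := congrArg Units.val hA
  simp only [Units.val_mul, Units.val_one] at h1
  rw [hprod]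
  exact h1

/-- A unit of `K_v` of valuation `1` congruent to `1 mod 𝔭_v^f` is killed by `⟨·⟩_v ↦ χ` when `χ_v` is trivial on the
higher unit group `U_v^{(f)}` (the `(v.adicCompletionIntegers K)ˣ`-form of `IsTrivialOnHigherUnitsAt`, unbundled).
[cite: LiXu2026, §2.1.1 (arXiv:2502.12648)] -/
theorem map_localUnits_eq_one_of_isTrivialOnHigherUnitsAt {χ : HeckeCharacter K} {v : HeightOneSpectrum (𝓞 K)}
    {f : ℕ} (h : χ.IsTrivialOnHigherUnitsAt v f) (u : (v.adicCompletion K)ˣ)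
    (hu : Valued.v (u : v.adicCompletion K) = 1)
    (hcong : Valued.v ((u : v.adicCompletion K) - 1) ≤ WithZero.exp (-(f : ℤ))) :
    χ (localUnits v u) = 1 := by
  have hu' : Valued.v ((u⁻¹ : (v.adicCompletion K)ˣ) : v.adicCompletion K) = 1 := by
    rw [Units.val_inv_eq_inv_val, map_inv₀, hu, inv_one]
  let w : (v.adicCompletionIntegers K)ˣ :=
    ⟨⟨(u : v.adicCompletion K), hu.le⟩, ⟨((u⁻¹ : (v.adicCompletion K)ˣ) : v.adicCompletion K),
      hu'.le⟩, Subtype.ext u.mul_inv, Subtype.ext u.inv_mul⟩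
  have hmap : Units.map ((v.adicCompletionIntegers K).subtype : _ →* _) w = u := Units.ext rfl
  have := h w hcong
  rwa [hmap, HeckeCharacter.localComponent_apply] at this

/-- **A module of definition from local conductor exponents.**  If `χ` is unramified at every place outside the finite set
`T` and `χ_v` is trivial on `U_v^{(f_v)}` for `v ∈ T` (e.g. `f_v = f(χ_v)`, `HasConductorExponentAt`), then `(T, f)` is a
module of definition of `χ`: a unit idele `x` with `x_∞ = 1` decomposes as `∏_{v ∈ T} ⟨x_v⟩_v` times an idele killed by any
module of definition supported on `T` (tree `exists_isModulus`, `IsModulus.of_isUnramifiedAt`,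
`IsModulus.coe_apply_eq_prod_localUnits_of_fst_eq_one`), and each `⟨x_v⟩_v`, `x_v ∈ U_v^{(f_v)}`, is killed by hypothesis.
[cite: NeukirchANT1999, Ch. VII §6 Def. (6.11) and the paragraph after it] [cite: LiXu2026, §2.1.1 (arXiv:2502.12648)] -/
theorem isModulus_of_isTrivialOnHigherUnitsAt {χ : HeckeCharacter K} (T : Finset (HeightOneSpectrum (𝓞 K)))
    (f : HeightOneSpectrum (𝓞 K) → ℕ) (hunr : ∀ v, v ∉ T → χ.IsUnramifiedAt v)
    (hf : ∀ v ∈ T, χ.IsTrivialOnHigherUnitsAt v (f v)) : IsModulus χ T f := by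
  obtain ⟨T₀, e₀, h₀⟩ := exists_isModulus χ
  have h₁ : IsModulus χ T e₀ := h₀.of_isUnramifiedAt fun v _ hvT => hunr v hvT
  intro x hx1 hxu hxc
  rw [h₁.coe_apply_eq_prod_localUnits_of_fst_eq_one x hx1 (S := T) le_rfl (fun w _ => hxu w)]
  refine Finset.prod_eq_one fun v hv => ?_
  exact map_localUnits_eq_one_of_isTrivialOnHigherUnitsAt (hf v hv) _ (by rw [Units.val_mk0]; exact hxu v)
    (by rw [Units.val_mk0]; exact hxc v hv)

end AnyField

/-! ## §2 The bridge on an imaginary quadratic field: `ψ((α)) = ι(α)` on the ray -/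

section Bridge

variable (Kcm : Type) [Field Kcm] [NumberField Kcm]

/-- For `χ` of infinity type `(1, 0)` on an imaginary quadratic field, `χ((k)_∞) = σ_{w}(k)⁻¹` for every `k ∈ Kˣ` and every
(= the) infinite place `w`. [cite: NeukirchANT1999, Ch. VII §6 Prop. (6.9) and (6.13)] -/
theorem coe_apply_infiniteIdeles_eq_inv_embedding (h2 : Module.finrank ℚ Kcm = 2) (s : Kcm) (hs : s ^ 2 = -7)
    {ψ : HeckeCharacter Kcm} (hψ : ψ.HasInfinityType (fun _ ↦ 1) (fun _ ↦ 0)) (w : InfinitePlace Kcm) (k : Kcmˣ) :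
    (ψ (infiniteIdeles Kcm (globalToInfiniteUnits Kcm k)) : ℂ) = (w.embedding (k : Kcm))⁻¹ := by
  haveI := MemberGrossencharacter.isTotallyComplex_of_sq_eq_neg_seven Kcm s hs
  haveI := MemberGrossencharacter.subsingleton_infinitePlace Kcm h2 s hs
  rw [hψ.apply_globalToInfiniteUnits_eq_of_isTotallyComplex k, Fintype.prod_subsingleton _ w]
  simp

/-- ★ **THE `ψ_conductor` BRIDGE (letter of `PinnedKatoGenusFrame.ψ_conductor` with `m := 7 * F.d`), from a module of
definition dividing `(m)`.**  Let `Kcm` be a quadratic number field with `s² = −7`, `ψ` a Hecke character of `Kcm` of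
infinity type `(1, 0)`, `ιC : K̄cm → ℂ` an embedding restricting to the infinite place(s) of `Kcm`, and `(T, f)` a module of
definition of `ψ` with `f_v ≥ 1` on `T` and `∏_{v ∈ T} 𝔭_v^{f_v} ∣ (m)`.  Then for every nonzero `α ∈ 𝓞 Kcm` with
`(m) ∣ α − 1`: `ψ((α)) = ιC(α)`, where `ψ((α)) = CM.heckeCharIdealValue ψ (span{α}) = ∏_𝔭 ψ(ϖ_𝔭)^{ord_𝔭 α}` — de Shalit's
`φ((α)) = α` on the ray (II.1.4 (12)), Kato's «`cond(ψ) ∣ (f)`» (Prop. 15.9).  Proof: §1's sharp Neukirch relation,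
`DepletedSeries.heckeCharIdealValue_eq_idealPow`, and `ψ((α)_∞) = σ(α)⁻¹` for type `(1,0)`.
[cite: deShalit1987, II.1.4 (12) (p. 35)] [cite: NeukirchANT1999, Ch. VII §6 Prop. (6.13)] [cite: Kato2004Asterisque, Prop. 15.9 (p. 258) and §15.7 (pp. 255–256)] -/
theorem heckeCharIdealValue_span_eq_of_isModulus (h2 : Module.finrank ℚ Kcm = 2) (s : Kcm) (hs : s ^ 2 = -7)
    {ψ : HeckeCharacter Kcm} (hψ : ψ.HasInfinityType (fun _ ↦ 1) (fun _ ↦ 0))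
    (ιC : AlgebraicClosure Kcm →+* ℂ)
    (hιC : ∀ (w : InfinitePlace Kcm) (x : Kcm), ιC (algebraMap Kcm (AlgebraicClosure Kcm) x) = w.embedding x)
    {T : Finset (HeightOneSpectrum (𝓞 Kcm))} {f : HeightOneSpectrum (𝓞 Kcm) → ℕ} (hmod : IsModulus ψ T f)
    (hf : ∀ v ∈ T, 1 ≤ f v) {m : ℕ} (hm : (∏ v ∈ T, v.asIdeal ^ f v) ∣ Ideal.span {((m : ℕ) : 𝓞 Kcm)}) :
    ∀ α : 𝓞 Kcm, α ≠ 0 → ((m : ℕ) : 𝓞 Kcm) ∣ α - 1 →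
      CM.heckeCharIdealValue ψ (Ideal.span {α}) = ιC (algebraMap Kcm (AlgebraicClosure Kcm) (α : Kcm)) := by
  intro α hα hdvd
  obtain ⟨w⟩ : Nonempty (InfinitePlace Kcm) := inferInstance
  have hαK : (α : Kcm) ≠ 0 := by exact_mod_cast hα
  have hα1 : α - 1 ∈ ∏ v ∈ T, v.asIdeal ^ f v :=
    Ideal.le_of_dvd hm (Ideal.mem_span_singleton.mpr hdvd)
  have hray := coe_apply_infiniteIdeles_mul_idealPow_span_eq_one_of_sub_one_mem hmod hf hαK hα1
  rw [coe_apply_infiniteIdeles_eq_inv_embedding Kcm h2 s hs hψ w] at hray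
  have hemb : w.embedding (α : Kcm) ≠ 0 := (map_ne_zero _).mpr hαK
  have hspan : (Ideal.span {α} : Ideal (𝓞 Kcm)) ≠ ⊥ := by
    rw [Ne, Ideal.span_singleton_eq_bot]; exact hα
  rw [DepletedSeries.heckeCharIdealValue_eq_idealPow ψ hspan, hιC w]
  calc LFunctions.idealPow Kcm (fun v => ψ.valueAtUniformizer v) (Ideal.span {α})
      = w.embedding (α : Kcm) * ((w.embedding (α : Kcm))⁻¹ *
          LFunctions.idealPow Kcm (fun v => ψ.valueAtUniformizer v) (Ideal.span {α})) := by
        rw [← mul_assoc, mul_inv_cancel₀ hemb, one_mul]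
    _ = w.embedding (α : Kcm) := by
        change w.embedding (α : Kcm) * ((w.embedding ((Units.mk0 (α : Kcm) hαK : Kcmˣ) : Kcm))⁻¹ * _) = _
        rw [hray, mul_one]

/-- ★★ **The bridge from LOCAL CONDUCTOR EXPONENTS** (the form in which Gross (8.2.7) and the tame-conductor theorems deliver
the hypothesis for a `𝒞₇` member): if `ψ` (type `(1,0)`) is unramified off the finite set `T`, `ψ_v` is trivial on
`U_v^{(f_v)}` with `f_v ≥ 1` for `v ∈ T`, and `∏_{v ∈ T} 𝔭_v^{f_v} ∣ (m)`, then `ψ((α)) = ιC(α)` for all nonzero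
`α ≡ 1 mod (m)`. [cite: deShalit1987, II.1.4 (12) (p. 35)] [cite: NeukirchANT1999, Ch. VII §6 (6.11), Prop. (6.13)]
[cite: LiXu2026, §2.1.1 (arXiv:2502.12648)] -/
theorem heckeCharIdealValue_span_eq_of_conductorExponents (h2 : Module.finrank ℚ Kcm = 2) (s : Kcm)
    (hs : s ^ 2 = -7) {ψ : HeckeCharacter Kcm} (hψ : ψ.HasInfinityType (fun _ ↦ 1) (fun _ ↦ 0))
    (ιC : AlgebraicClosure Kcm →+* ℂ)
    (hιC : ∀ (w : InfinitePlace Kcm) (x : Kcm), ιC (algebraMap Kcm (AlgebraicClosure Kcm) x) = w.embedding x)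
    (T : Finset (HeightOneSpectrum (𝓞 Kcm))) (f : HeightOneSpectrum (𝓞 Kcm) → ℕ)
    (hunr : ∀ v, v ∉ T → ψ.IsUnramifiedAt v) (htriv : ∀ v ∈ T, ψ.IsTrivialOnHigherUnitsAt v (f v))
    (hf : ∀ v ∈ T, 1 ≤ f v) {m : ℕ} (hm : (∏ v ∈ T, v.asIdeal ^ f v) ∣ Ideal.span {((m : ℕ) : 𝓞 Kcm)}) :
    ∀ α : 𝓞 Kcm, α ≠ 0 → ((m : ℕ) : 𝓞 Kcm) ∣ α - 1 →
      CM.heckeCharIdealValue ψ (Ideal.span {α}) = ιC (algebraMap Kcm (AlgebraicClosure Kcm) (α : Kcm)) :=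
  heckeCharIdealValue_span_eq_of_isModulus Kcm h2 s hs hψ ιC hιC
    (isModulus_of_isTrivialOnHigherUnitsAt T f hunr htriv) hf hm

/-- ★★ The same with the conductor exponents in the EXACT currency `HasConductorExponentAt` (`f_v = f(ψ_v)`).
[cite: LiXu2026, §2.1.1 (arXiv:2502.12648)] [cite: NeukirchANT1999, Ch. VII §6 Prop. (6.13)] -/
theorem heckeCharIdealValue_span_eq_of_hasConductorExponentAt (h2 : Module.finrank ℚ Kcm = 2) (s : Kcm)
    (hs : s ^ 2 = -7) {ψ : HeckeCharacter Kcm} (hψ : ψ.HasInfinityType (fun _ ↦ 1) (fun _ ↦ 0))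
    (ιC : AlgebraicClosure Kcm →+* ℂ)
    (hιC : ∀ (w : InfinitePlace Kcm) (x : Kcm), ιC (algebraMap Kcm (AlgebraicClosure Kcm) x) = w.embedding x)
    (T : Finset (HeightOneSpectrum (𝓞 Kcm))) (f : HeightOneSpectrum (𝓞 Kcm) → ℕ)
    (hunr : ∀ v, v ∉ T → ψ.IsUnramifiedAt v) (hcond : ∀ v ∈ T, ψ.HasConductorExponentAt v (f v))
    (hf : ∀ v ∈ T, 1 ≤ f v) {m : ℕ} (hm : (∏ v ∈ T, v.asIdeal ^ f v) ∣ Ideal.span {((m : ℕ) : 𝓞 Kcm)}) :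
    ∀ α : 𝓞 Kcm, α ≠ 0 → ((m : ℕ) : 𝓞 Kcm) ∣ α - 1 →
      CM.heckeCharIdealValue ψ (Ideal.span {α}) = ιC (algebraMap Kcm (AlgebraicClosure Kcm) (α : Kcm)) :=
  heckeCharIdealValue_span_eq_of_conductorExponents Kcm h2 s hs hψ ιC hιC T f hunr (fun v hv => (hcond v hv).1) hf hm

end Bridge

end Summit.BirchSwinnertonDyer.Rank1Residual.Additive.GenusSeven.ConductorBridge

end
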